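import Literature.AlgebraicGeometry.AbelianSchemes.AbelianSchemeSymplecticLevelTransfer
import HarnessLib

/-!
# Transfer of a SINGLE-LEVEL symplectic datum along an isomorphism of (fibre) abelian varieties
# ([Lan2013PELCompactifications] Lemma 1.3.6.5 / 1.3.6.6 at one level `m`; [MumfordAV1970] §20 (3))

Cell `hodgecm-mathlib`, F-DAG (h9-S) «symplectic liftability from ONE geometric point», piece (W3c-T) (B-plan1 (g15)
2026-08-30 05:16:25Z; lead of (W3) B-p11 (g16); census `B-provers/B-p13/g18/CENSUS-h9S-W3-Assembly` §2).  ★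
`AbelianSchemeSymplecticLevelTransfer` transports a whole symplectic LIFT (the compatible tower `(ζ_M, lift_M)_{N ∣ M}`
of ★ `AbelianSchemeSymplecticLevel`) along an isomorphism `e : A′_{s′} ≅ A_s` of fibre abelian varieties carrying the
level sections to the level sections.  By ★ `SymplecticLiftOfFiniteLevels` the existence of a lift is a LEVEL-BY-LEVEL
condition, and the (W3c) assembly produces and consumes the data ONE LEVEL AT A TIME (at the second geometric point only
a single-level similitude is available, from ★ `SimilitudeTransport`).  This file is the single-level form of
(T0)/(T1)/(T2), stated in EXACTLY the datum shape `nonempty_symplecticLift_iff_forall_level` reads: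

  «`∃ ζ L, IsPrimitiveRoot ζ m ∧ Bijective L ∧ (∀ i, (L eᵢ)^k = mᵢ) ∧ ∀ (hm : (m : K) ≠ 0) x y, ē^Θ_m(L x, L y) = ζ^{E_δ(x,y)}`»

for an abelian variety `X/K`, a Cartier divisor `Θ` on `X`, marks `mᵢ ∈ X(K)` (`i : Fin g ⊕ Fin g`) and a level `m`:

* §1 (any abelian varieties `e : X′ ≅ X`, marks `hm : e(m′ᵢ) = mᵢ`): `exists_levelDatum_of_linEquiv` (T0ₘ, ★
  `weilPairingLevel_congr_linEquiv`); `exists_levelDatum_transport` (T1ₘ: a datum for `(X, m, Θ)` gives one for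
  `(X′, m′, e^*Θ)` with the SAME `ζ` and `L′ := e⁻¹ ∘ L`, ★ `weilPairingLevel_pullback_eq`);
  `exists_levelDatum_of_transport` (T1ₘ⁻¹: a datum for `(X′, m′, e^*Θ)` gives one for `(X, m, Θ)`);
  `exists_levelDatum_of_pullback_inv` (T2ₘ: a datum for `(X, m, (e⁻¹)^*Θ′)` gives one for `(X′, m′, Θ′)`);
* §2 (geometric fibres of abelian schemes, marks `σᵢ(s)`; the literal (S1) shape with `m = k·N`):
  `LevelStructure.exists_level_transport` / `exists_level_of_transport` / `exists_level_of_pullback_inv`, and the tower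
  corollary `LevelStructure.nonempty_symplecticLift_transport_iff` (from ★ (T1) both ways and ★ (T0)).

Theorems only; no definition, no named fact, no instance, no `sorry`.  HC_CM is proved only modulo the 7 printed
citations until rung 0 closes; nothing here discharges a binder (count-neutral capital for F-6 (V′)).

## References
* [Lan2013PELCompactifications] K.-W. Lan, *Arithmetic compactifications of PEL-type Shimura varieties* (2013), §1.3.6
  Def. 1.3.6.1–1.3.6.2 (pp. 79–80), Lemma 1.3.6.5 (p. 81), Lemma 1.3.6.6 and Cor. 1.3.6.7 (pp. 81–82).
* [MumfordAV1970] D. Mumford, *Abelian Varieties* (1970), §20, property (3) of `e_n` (p. 186).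
* [Lang1983AbelianVarieties] S. Lang, *Abelian Varieties*, Ch. VII §2 Prop. 3.
* Tree: ★ `AbelianSchemeSymplecticLevelTransfer` (T0/T1/T2), ★ `AbelianSchemeSymplecticLevel`, ★
  `Motives.AbelianVarietyWeilPairingPullback`, ★ `Motives.AbelianVarietyWeilPairingDivisorClass`.
-/

noncomputable section

universe u

open CategoryTheory CategoryTheory.Limits AlgebraicGeometry

namespace Literature.AlgebraicGeometry.AbelianSchemes

namespace AbelianSchemeOver

open Literature.AlgebraicGeometry.Motives
open scoped MonObj

/-! ### §1 Single-level data on abelian varieties: linear equivalence of the witness and transport along `e : X′ ≅ X` -/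

section AbelianVariety

variable {K : Type u} [Field K] {X X' : AbelianVariety K} {g : ℕ} {δ : Fin g → ℕ} {m k : ℕ}

/-- **(T0ₘ) A single-level symplectic datum for `Θ` is one for every linearly equivalent `Θ′`** — the level Weil
pairing `ē^Θ_m` depends only on the linear equivalence class of `Θ` (★ `weilPairingLevel_congr_linEquiv`); the root
`ζ`, the similitude `L` and the marks clause do not mention `Θ`.
[cite: Lang1983AbelianVarieties, Ch. VII §2 Prop. 3] [cite: Lan2013PELCompactifications, §1.3.6 Lemma 1.3.6.5 (p. 81)] -/
theorem exists_levelDatum_of_linEquiv {Θ Θ' : CartierDivisor X.X.left} (h : Θ.LinEquiv Θ')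
    (mk : Fin g ⊕ Fin g → X.Points K)
    (hd : ∃ (ζ : K) (L : Multiplicative (Fin g ⊕ Fin g → ZMod m) →* X.torsionPoints K (m : ℤ)),
      IsPrimitiveRoot ζ m ∧ Function.Bijective L ∧
      (∀ i : Fin g ⊕ Fin g, ((L (Multiplicative.ofAdd (Pi.single i 1))) : X.Points K) ^ k = mk i) ∧
      ∀ (hmK : (m : K) ≠ 0) (x y : Fin g ⊕ Fin g → ZMod m),
        haveI := AbelianVariety.isDominant_toSchemeHom_zsmul_of_ne_zero X hmK
        X.weilPairingLevel Θ (L (Multiplicative.ofAdd x)) (L (Multiplicative.ofAdd y)) =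
          ζ ^ (typeFormMod δ m x y).val) :
    ∃ (ζ : K) (L : Multiplicative (Fin g ⊕ Fin g → ZMod m) →* X.torsionPoints K (m : ℤ)),
      IsPrimitiveRoot ζ m ∧ Function.Bijective L ∧
      (∀ i : Fin g ⊕ Fin g, ((L (Multiplicative.ofAdd (Pi.single i 1))) : X.Points K) ^ k = mk i) ∧
      ∀ (hmK : (m : K) ≠ 0) (x y : Fin g ⊕ Fin g → ZMod m),
        haveI := AbelianVariety.isDominant_toSchemeHom_zsmul_of_ne_zero X hmK
        X.weilPairingLevel Θ' (L (Multiplicative.ofAdd x)) (L (Multiplicative.ofAdd y)) =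
          ζ ^ (typeFormMod δ m x y).val := by
  obtain ⟨ζ, L, hζ, hL, hmk, hpair⟩ := hd
  refine ⟨ζ, L, hζ, hL, hmk, fun hmK x y => ?_⟩
  haveI := AbelianVariety.isDominant_toSchemeHom_zsmul_of_ne_zero X hmK
  rw [← AbelianVariety.weilPairingLevel_congr_linEquiv h]
  exact hpair hmK x y

/-- The marks hypothesis for `e⁻¹` from the one for `e`: if `e(m′ᵢ) = mᵢ` then `e⁻¹(mᵢ) = m′ᵢ`.
[cite: MumfordAV1970, §20 (property (3) of e_n, p. 186)] -/
theorem map_inv_eq_of_map_hom_eq (e : X' ≅ X) {mk : Fin g ⊕ Fin g → X.Points K}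
    {mk' : Fin g ⊕ Fin g → X'.Points K} (hm : ∀ i : Fin g ⊕ Fin g, AlgPoints.map e.hom.hom.hom.hom (mk' i) = mk i)
    (i : Fin g ⊕ Fin g) : AlgPoints.map e.inv.hom.hom.hom (mk i) = mk' i := by
  rw [← hm i, ← AlgPoints.map_comp_apply]
  change AlgPoints.map (e.hom ≫ e.inv).hom.hom.hom (mk' i) = mk' i
  rw [e.hom_inv_id]
  exact AlgPoints.map_id_apply (mk' i)

/-- **(T1ₘ) TRANSPORT of a single-level symplectic datum along an isomorphism of abelian varieties compatible with the
marks.**  Let `e : X′ ≅ X` carry the marks `m′ᵢ ∈ X′(K)` to the marks `mᵢ ∈ X(K)` (`hm : e(m′ᵢ) = mᵢ`).  A level-`m`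
datum `(ζ, L)` for `(X, m, Θ)` — `ζ` a primitive `m`-th root, `L : (ℤ/m)^{2g} ⥲ X[m](K)` with `L(eᵢ)^k = mᵢ` and
`ē^Θ_m(L x, L y) = ζ^{E_δ(x, y)}` — yields the datum `(ζ, e⁻¹ ∘ L)` for `(X′, m′, e^*Θ)`: bijectivity and the marks
clause transport along `e⁻¹` on points; the pairing clause is Mumford's functoriality `ē^{e^*Θ}_m(e⁻¹P, e⁻¹Q) =
ē^Θ_m(P, Q)` (★ `weilPairingLevel_pullback_eq`).  Single-level ★ (T1). [cite: MumfordAV1970, §20 (property (3) of e_n, p. 186)]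
[cite: Lan2013PELCompactifications, §1.3.6 Lemma 1.3.6.5 (p. 81) and Lemma 1.3.6.6 (pp. 81–82)] -/
theorem exists_levelDatum_transport (e : X' ≅ X) {mk : Fin g ⊕ Fin g → X.Points K}
    {mk' : Fin g ⊕ Fin g → X'.Points K} (hm : ∀ i : Fin g ⊕ Fin g, AlgPoints.map e.hom.hom.hom.hom (mk' i) = mk i)
    (Θ : CartierDivisor X.X.left)
    (hd : ∃ (ζ : K) (L : Multiplicative (Fin g ⊕ Fin g → ZMod m) →* X.torsionPoints K (m : ℤ)),
      IsPrimitiveRoot ζ m ∧ Function.Bijective L ∧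
      (∀ i : Fin g ⊕ Fin g, ((L (Multiplicative.ofAdd (Pi.single i 1))) : X.Points K) ^ k = mk i) ∧
      ∀ (hmK : (m : K) ≠ 0) (x y : Fin g ⊕ Fin g → ZMod m),
        haveI := AbelianVariety.isDominant_toSchemeHom_zsmul_of_ne_zero X hmK
        X.weilPairingLevel Θ (L (Multiplicative.ofAdd x)) (L (Multiplicative.ofAdd y)) =
          ζ ^ (typeFormMod δ m x y).val) :
    haveI := AbelianVariety.isDominant_toSchemeHom_iso_hom e
    ∃ (ζ : K) (L' : Multiplicative (Fin g ⊕ Fin g → ZMod m) →* X'.torsionPoints K (m : ℤ)),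
      IsPrimitiveRoot ζ m ∧ Function.Bijective L' ∧
      (∀ i : Fin g ⊕ Fin g, ((L' (Multiplicative.ofAdd (Pi.single i 1))) : X'.Points K) ^ k = mk' i) ∧
      ∀ (hmK : (m : K) ≠ 0) (x y : Fin g ⊕ Fin g → ZMod m),
        haveI := AbelianVariety.isDominant_toSchemeHom_zsmul_of_ne_zero X' hmK
        X'.weilPairingLevel (Θ.pullback (AbelianVariety.Hom.toSchemeHom e.hom)) (L' (Multiplicative.ofAdd x))
            (L' (Multiplicative.ofAdd y)) = ζ ^ (typeFormMod δ m x y).val := by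
  haveI := AbelianVariety.isDominant_toSchemeHom_iso_hom e
  obtain ⟨ζ, L, hζ, hL, hmk, hpair⟩ := hd
  -- the maps on `K`-points induced by `e` and `e⁻¹`
  let fwd : X'.Points K →* X.Points K := IsMonHom.monoidHom e.hom.hom.hom.hom (specOver K K)
  let bwd : X.Points K →* X'.Points K := IsMonHom.monoidHom e.inv.hom.hom.hom (specOver K K)
  have hfwd : ∀ P, fwd P = AlgPoints.map e.hom.hom.hom.hom P := fun P => rfl
  have hfb : ∀ P, fwd (bwd P) = P := fun P => by
    change AlgPoints.map e.hom.hom.hom.hom (AlgPoints.map e.inv.hom.hom.hom P) = P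
    rw [← AlgPoints.map_comp_apply]
    change AlgPoints.map (e.inv ≫ e.hom).hom.hom.hom P = P
    rw [e.inv_hom_id]
    exact AlgPoints.map_id_apply P
  have hbf : ∀ P, bwd (fwd P) = P := fun P => by
    change AlgPoints.map e.inv.hom.hom.hom (AlgPoints.map e.hom.hom.hom.hom P) = P
    rw [← AlgPoints.map_comp_apply]
    change AlgPoints.map (e.hom ≫ e.inv).hom.hom.hom P = P
    rw [e.hom_inv_id]
    exact AlgPoints.map_id_apply P
  -- `e⁻¹` on the `m`-torsion
  have hbwd_mem : ∀ P : X.torsionPoints K (m : ℤ), bwd P ∈ X'.torsionPoints K (m : ℤ) := fun P => by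
    rw [AbelianVariety.mem_torsionPoints_iff, ← map_zpow, (AbelianVariety.mem_torsionPoints_iff _ _).1 P.2, map_one]
  let bwdT : X.torsionPoints K (m : ℤ) →* X'.torsionPoints K (m : ℤ) :=
    (bwd.comp (X.torsionPoints K (m : ℤ)).subtype).codRestrict _ hbwd_mem
  have hbwdT : ∀ P : X.torsionPoints K (m : ℤ), ((bwdT P : X'.torsionPoints K (m : ℤ)) : X'.Points K) = bwd P :=
    fun P => rfl
  refine ⟨ζ, bwdT.comp L, hζ, ?_, fun i => ?_, fun hmK x y => ?_⟩
  · -- bijectivity: `e⁻¹` is a bijection on torsion points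
    have hinj : Function.Injective bwdT := fun P Q hPQ => by
      have h := congrArg (fun R : X'.torsionPoints K (m : ℤ) => fwd (R : X'.Points K)) hPQ
      simp only [hbwdT, hfb] at h
      exact Subtype.ext h
    have hsurj : Function.Surjective bwdT := fun Q => by
      have hQ' : fwd Q ∈ X.torsionPoints K (m : ℤ) := by
        rw [AbelianVariety.mem_torsionPoints_iff, ← map_zpow, (AbelianVariety.mem_torsionPoints_iff _ _).1 Q.2,
          map_one]
      refine ⟨⟨fwd Q, hQ'⟩, Subtype.ext ?_⟩
      rw [hbwdT]
      exact hbf Q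
    rw [MonoidHom.coe_comp]
    exact (show Function.Bijective bwdT from ⟨hinj, hsurj⟩).comp hL
  · -- marks: `(e⁻¹ L(eᵢ))^k = e⁻¹ (L(eᵢ)^k) = e⁻¹ mᵢ = m′ᵢ`
    rw [MonoidHom.comp_apply, hbwdT, ← map_pow, hmk i]
    exact map_inv_eq_of_map_hom_eq e hm i
  · -- the pairing clause: `ē^{e^*Θ}(e⁻¹P, e⁻¹Q) = ē^Θ(P, Q) = ζ ^ E_δ`
    haveI := AbelianVariety.isDominant_toSchemeHom_zsmul_of_ne_zero X' hmK
    haveI := AbelianVariety.isDominant_toSchemeHom_zsmul_of_ne_zero X hmK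
    have hP : ((L (Multiplicative.ofAdd x) : X.torsionPoints K (m : ℤ)) : X.Points K) =
        AlgPoints.map e.hom.hom.hom.hom
          ((bwdT.comp L (Multiplicative.ofAdd x) : X'.torsionPoints K (m : ℤ)) : X'.Points K) := by
      rw [MonoidHom.comp_apply, hbwdT, ← hfwd, hfb]
    have hQ : ((L (Multiplicative.ofAdd y) : X.torsionPoints K (m : ℤ)) : X.Points K) =
        AlgPoints.map e.hom.hom.hom.hom
          ((bwdT.comp L (Multiplicative.ofAdd y) : X'.torsionPoints K (m : ℤ)) : X'.Points K) := by
      rw [MonoidHom.comp_apply, hbwdT, ← hfwd, hfb]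
    have key := AbelianVariety.weilPairingLevel_pullback_eq e.hom Θ
      (bwdT.comp L (Multiplicative.ofAdd x)) (bwdT.comp L (Multiplicative.ofAdd y))
      (L (Multiplicative.ofAdd x)) (L (Multiplicative.ofAdd y)) hP hQ
    have hΛ := hpair hmK x y
    convert key.trans hΛ using 1

/-- `e^*(e⁻¹)^*Θ′` is the same divisor as `Θ′` (same local equations).
[cite: MumfordAV1970, §20 (property (3) of e_n, p. 186)] -/
theorem pullback_inv_pullback_hom_sameDivisor (e : X' ≅ X) (Θ' : CartierDivisor X'.X.left) :
    haveI := AbelianVariety.isDominant_toSchemeHom_iso_hom e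
    haveI : IsDominant (AbelianVariety.Hom.toSchemeHom e.inv) := AbelianVariety.isDominant_toSchemeHom_iso_hom e.symm
    ((Θ'.pullback (AbelianVariety.Hom.toSchemeHom e.inv)).pullback
      (AbelianVariety.Hom.toSchemeHom e.hom)).SameDivisor Θ' := by
  haveI := AbelianVariety.isDominant_toSchemeHom_iso_hom e
  haveI : IsDominant (AbelianVariety.Hom.toSchemeHom e.inv) := AbelianVariety.isDominant_toSchemeHom_iso_hom e.symm
  refine (Θ'.pullback_pullback_sameDivisor _ _).trans ?_
  have hcomp : AbelianVariety.Hom.toSchemeHom e.hom ≫ AbelianVariety.Hom.toSchemeHom e.inv = 𝟙 _ := by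
    change AbelianVariety.Hom.toSchemeHom (e.hom ≫ e.inv) = _
    rw [e.hom_inv_id]
    rfl
  exact (Θ'.pullback_congr_sameDivisor hcomp).trans Θ'.pullback_id_sameDivisor

/-- `(e⁻¹)^*e^*Θ` is the same divisor as `Θ`. [cite: MumfordAV1970, §20 (property (3) of e_n, p. 186)] -/
theorem pullback_hom_pullback_inv_sameDivisor (e : X' ≅ X) (Θ : CartierDivisor X.X.left) :
    haveI := AbelianVariety.isDominant_toSchemeHom_iso_hom e
    haveI : IsDominant (AbelianVariety.Hom.toSchemeHom e.inv) := AbelianVariety.isDominant_toSchemeHom_iso_hom e.symm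
    ((Θ.pullback (AbelianVariety.Hom.toSchemeHom e.hom)).pullback
      (AbelianVariety.Hom.toSchemeHom e.inv)).SameDivisor Θ :=
  pullback_inv_pullback_hom_sameDivisor e.symm Θ

/-- **(T1ₘ⁻¹) A single-level datum for `(X′, m′, e^*Θ)` gives one for `(X, m, Θ)`** (transport back along `e⁻¹`,
then `(e⁻¹)^*e^*Θ ∼ Θ` and (T0ₘ)).  This is the direction the (W3c) assembly uses at the SECOND geometric point: the
single-level similitude produced on the fibre of the finite étale cover is read on the fibre of `A` itself.
[cite: Lan2013PELCompactifications, §1.3.6 Lemma 1.3.6.6 and Cor. 1.3.6.7 (pp. 81–82)]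
[cite: MumfordAV1970, §20 (property (3) of e_n, p. 186)] -/
theorem exists_levelDatum_of_transport (e : X' ≅ X) {mk : Fin g ⊕ Fin g → X.Points K}
    {mk' : Fin g ⊕ Fin g → X'.Points K} (hm : ∀ i : Fin g ⊕ Fin g, AlgPoints.map e.hom.hom.hom.hom (mk' i) = mk i)
    (Θ : CartierDivisor X.X.left)
    (hd : haveI := AbelianVariety.isDominant_toSchemeHom_iso_hom e
      ∃ (ζ : K) (L' : Multiplicative (Fin g ⊕ Fin g → ZMod m) →* X'.torsionPoints K (m : ℤ)),
      IsPrimitiveRoot ζ m ∧ Function.Bijective L' ∧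
      (∀ i : Fin g ⊕ Fin g, ((L' (Multiplicative.ofAdd (Pi.single i 1))) : X'.Points K) ^ k = mk' i) ∧
      ∀ (hmK : (m : K) ≠ 0) (x y : Fin g ⊕ Fin g → ZMod m),
        haveI := AbelianVariety.isDominant_toSchemeHom_zsmul_of_ne_zero X' hmK
        X'.weilPairingLevel (Θ.pullback (AbelianVariety.Hom.toSchemeHom e.hom)) (L' (Multiplicative.ofAdd x))
            (L' (Multiplicative.ofAdd y)) = ζ ^ (typeFormMod δ m x y).val) :
    ∃ (ζ : K) (L : Multiplicative (Fin g ⊕ Fin g → ZMod m) →* X.torsionPoints K (m : ℤ)),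
      IsPrimitiveRoot ζ m ∧ Function.Bijective L ∧
      (∀ i : Fin g ⊕ Fin g, ((L (Multiplicative.ofAdd (Pi.single i 1))) : X.Points K) ^ k = mk i) ∧
      ∀ (hmK : (m : K) ≠ 0) (x y : Fin g ⊕ Fin g → ZMod m),
        haveI := AbelianVariety.isDominant_toSchemeHom_zsmul_of_ne_zero X hmK
        X.weilPairingLevel Θ (L (Multiplicative.ofAdd x)) (L (Multiplicative.ofAdd y)) =
          ζ ^ (typeFormMod δ m x y).val := by
  haveI := AbelianVariety.isDominant_toSchemeHom_iso_hom e
  haveI : IsDominant (AbelianVariety.Hom.toSchemeHom e.inv) := AbelianVariety.isDominant_toSchemeHom_iso_hom e.symm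
  -- transport along `e⁻¹ : X ≅ X′` (marks hypothesis `e⁻¹(mᵢ) = m′ᵢ`), landing on `(e⁻¹)^* e^* Θ ∼ Θ`
  have h := exists_levelDatum_transport (δ := δ) e.symm (mk := mk') (mk' := mk) (map_inv_eq_of_map_hom_eq e hm)
    (Θ.pullback (AbelianVariety.Hom.toSchemeHom e.hom)) hd
  exact exists_levelDatum_of_linEquiv (pullback_hom_pullback_inv_sameDivisor e Θ).linEquiv mk h

/-- **(T2ₘ) A single-level datum for `(X, m, (e⁻¹)^*Θ′)` gives one for `(X′, m′, Θ′)`** — transport along `e` by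
(T1ₘ) to `e^*(e⁻¹)^*Θ′`, the same divisor as `Θ′`, and conclude by (T0ₘ).  Single-level form of the pointwise step
of ★ (T2) `IsSymplecticLiftable.of_fibreIso` (there with `Θ′` an ample witness of the target polarisation and
`(e⁻¹)^*Θ′` the transferred witness). [cite: Lan2013PELCompactifications, §1.3.6 Lemma 1.3.6.6 and Cor. 1.3.6.7 (pp. 81–82)]
[cite: MumfordAV1970, §20 (property (3) of e_n, p. 186)] -/
theorem exists_levelDatum_of_pullback_inv (e : X' ≅ X) {mk : Fin g ⊕ Fin g → X.Points K}
    {mk' : Fin g ⊕ Fin g → X'.Points K} (hm : ∀ i : Fin g ⊕ Fin g, AlgPoints.map e.hom.hom.hom.hom (mk' i) = mk i)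
    (Θ' : CartierDivisor X'.X.left)
    (hd : haveI : IsDominant (AbelianVariety.Hom.toSchemeHom e.inv) :=
        AbelianVariety.isDominant_toSchemeHom_iso_hom e.symm
      ∃ (ζ : K) (L : Multiplicative (Fin g ⊕ Fin g → ZMod m) →* X.torsionPoints K (m : ℤ)),
      IsPrimitiveRoot ζ m ∧ Function.Bijective L ∧
      (∀ i : Fin g ⊕ Fin g, ((L (Multiplicative.ofAdd (Pi.single i 1))) : X.Points K) ^ k = mk i) ∧
      ∀ (hmK : (m : K) ≠ 0) (x y : Fin g ⊕ Fin g → ZMod m),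
        haveI := AbelianVariety.isDominant_toSchemeHom_zsmul_of_ne_zero X hmK
        X.weilPairingLevel (Θ'.pullback (AbelianVariety.Hom.toSchemeHom e.inv)) (L (Multiplicative.ofAdd x))
            (L (Multiplicative.ofAdd y)) = ζ ^ (typeFormMod δ m x y).val) :
    ∃ (ζ : K) (L' : Multiplicative (Fin g ⊕ Fin g → ZMod m) →* X'.torsionPoints K (m : ℤ)),
      IsPrimitiveRoot ζ m ∧ Function.Bijective L' ∧
      (∀ i : Fin g ⊕ Fin g, ((L' (Multiplicative.ofAdd (Pi.single i 1))) : X'.Points K) ^ k = mk' i) ∧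
      ∀ (hmK : (m : K) ≠ 0) (x y : Fin g ⊕ Fin g → ZMod m),
        haveI := AbelianVariety.isDominant_toSchemeHom_zsmul_of_ne_zero X' hmK
        X'.weilPairingLevel Θ' (L' (Multiplicative.ofAdd x)) (L' (Multiplicative.ofAdd y)) =
          ζ ^ (typeFormMod δ m x y).val := by
  haveI := AbelianVariety.isDominant_toSchemeHom_iso_hom e
  haveI : IsDominant (AbelianVariety.Hom.toSchemeHom e.inv) := AbelianVariety.isDominant_toSchemeHom_iso_hom e.symm
  have h := exists_levelDatum_transport (δ := δ) e hm (Θ'.pullback (AbelianVariety.Hom.toSchemeHom e.inv)) hd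
  exact exists_levelDatum_of_linEquiv (pullback_inv_pullback_hom_sameDivisor e Θ').linEquiv mk' h

end AbelianVariety

/-! ### §2 Geometric fibres of abelian schemes: the literal (S1) shape (marks `σᵢ(s)`, level `k·N`) -/

section Fibres

variable {S S' : Scheme.{u}} {A : AbelianSchemeOver S} {A' : AbelianSchemeOver S'} {g N : ℕ}
  {φ : A.LevelStructure g N} {φ' : A'.LevelStructure g N} {Ω : Type u} [Field Ω]
  {s : Spec (.of Ω) ⟶ S} {s' : Spec (.of Ω) ⟶ S'} {δ : Fin g → ℕ} {k : ℕ}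

/-- **Transport of a level-`kN` symplectic similitude lifting `φ(s)` along a fibre isomorphism carrying the level
sections** — (T1ₖ) in the literal shape of ★ `nonempty_symplecticLift_iff_forall_level`: for
`e : A′_{s′} ≅ A_s` with `e(σ′ᵢ(s′)) = σᵢ(s)`, a level-`kN` datum `(ζ, L)` for `φ` at `s` and the witness `Θ` gives the
datum `(ζ, e⁻¹ ∘ L)` for `φ′` at `s′` and the witness `e^*Θ`.
[cite: Lan2013PELCompactifications, §1.3.6 Lemma 1.3.6.5 (p. 81) and Lemma 1.3.6.6 (pp. 81–82)]
[cite: MumfordAV1970, §20 (property (3) of e_n, p. 186)] -/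
theorem LevelStructure.exists_level_transport
    (e : (A'.fibre s').toAbelianVariety ≅ (A.fibre s).toAbelianVariety)
    (he : ∀ i : Fin g ⊕ Fin g,
      AlgPoints.map e.hom.hom.hom.hom (A'.restrictPt s' (φ'.σ i)) = A.restrictPt s (φ.σ i))
    (Θ : CartierDivisor (A.fibre s).toAbelianVariety.X.left)
    (hd : ∃ (ζ : Ω) (L : Multiplicative (Fin g ⊕ Fin g → ZMod (k * N)) →*
          (A.fibre s).toAbelianVariety.torsionPoints Ω ((k * N : ℕ) : ℤ)),
        IsPrimitiveRoot ζ (k * N) ∧ Function.Bijective L ∧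
        (∀ i : Fin g ⊕ Fin g, ((L (Multiplicative.ofAdd (Pi.single i 1))) : (A.fibre s).toAbelianVariety.Points Ω) ^ k =
          A.restrictPt s (φ.σ i)) ∧
        ∀ (hMΩ : ((k * N : ℕ) : Ω) ≠ 0) (x y : Fin g ⊕ Fin g → ZMod (k * N)),
          haveI := AbelianVariety.isDominant_toSchemeHom_zsmul_of_ne_zero (A.fibre s).toAbelianVariety hMΩ
          (A.fibre s).toAbelianVariety.weilPairingLevel Θ (L (Multiplicative.ofAdd x)) (L (Multiplicative.ofAdd y)) =
            ζ ^ (typeFormMod δ (k * N) x y).val) :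
    haveI := AbelianVariety.isDominant_toSchemeHom_iso_hom e
    ∃ (ζ : Ω) (L' : Multiplicative (Fin g ⊕ Fin g → ZMod (k * N)) →*
        (A'.fibre s').toAbelianVariety.torsionPoints Ω ((k * N : ℕ) : ℤ)),
      IsPrimitiveRoot ζ (k * N) ∧ Function.Bijective L' ∧
      (∀ i : Fin g ⊕ Fin g, ((L' (Multiplicative.ofAdd (Pi.single i 1))) : (A'.fibre s').toAbelianVariety.Points Ω) ^ k =
        A'.restrictPt s' (φ'.σ i)) ∧
      ∀ (hMΩ : ((k * N : ℕ) : Ω) ≠ 0) (x y : Fin g ⊕ Fin g → ZMod (k * N)),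
        haveI := AbelianVariety.isDominant_toSchemeHom_zsmul_of_ne_zero (A'.fibre s').toAbelianVariety hMΩ
        (A'.fibre s').toAbelianVariety.weilPairingLevel (Θ.pullback (AbelianVariety.Hom.toSchemeHom e.hom))
            (L' (Multiplicative.ofAdd x)) (L' (Multiplicative.ofAdd y)) = ζ ^ (typeFormMod δ (k * N) x y).val :=
  exists_levelDatum_transport e he Θ hd

/-- **A level-`kN` symplectic similitude lifting `φ′(s′)` for the witness `e^*Θ` gives one lifting `φ(s)` for `Θ`**
— (T1ₖ⁻¹) in the literal (S1) shape; the direction the (W3c) assembly uses at the second geometric point (`A′` the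
pull-back of `A` to the connected finite étale cover trivialising the level-`kN` torsion, `e` the fibre identification).
[cite: Lan2013PELCompactifications, §1.3.6 Lemma 1.3.6.6 and Cor. 1.3.6.7 (pp. 81–82)]
[cite: MumfordAV1970, §20 (property (3) of e_n, p. 186)] -/
theorem LevelStructure.exists_level_of_transport
    (e : (A'.fibre s').toAbelianVariety ≅ (A.fibre s).toAbelianVariety)
    (he : ∀ i : Fin g ⊕ Fin g,
      AlgPoints.map e.hom.hom.hom.hom (A'.restrictPt s' (φ'.σ i)) = A.restrictPt s (φ.σ i))
    (Θ : CartierDivisor (A.fibre s).toAbelianVariety.X.left)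
    (hd : haveI := AbelianVariety.isDominant_toSchemeHom_iso_hom e
      ∃ (ζ : Ω) (L' : Multiplicative (Fin g ⊕ Fin g → ZMod (k * N)) →*
          (A'.fibre s').toAbelianVariety.torsionPoints Ω ((k * N : ℕ) : ℤ)),
        IsPrimitiveRoot ζ (k * N) ∧ Function.Bijective L' ∧
        (∀ i : Fin g ⊕ Fin g,
          ((L' (Multiplicative.ofAdd (Pi.single i 1))) : (A'.fibre s').toAbelianVariety.Points Ω) ^ k =
            A'.restrictPt s' (φ'.σ i)) ∧
        ∀ (hMΩ : ((k * N : ℕ) : Ω) ≠ 0) (x y : Fin g ⊕ Fin g → ZMod (k * N)),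
          haveI := AbelianVariety.isDominant_toSchemeHom_zsmul_of_ne_zero (A'.fibre s').toAbelianVariety hMΩ
          (A'.fibre s').toAbelianVariety.weilPairingLevel (Θ.pullback (AbelianVariety.Hom.toSchemeHom e.hom))
              (L' (Multiplicative.ofAdd x)) (L' (Multiplicative.ofAdd y)) = ζ ^ (typeFormMod δ (k * N) x y).val) :
    ∃ (ζ : Ω) (L : Multiplicative (Fin g ⊕ Fin g → ZMod (k * N)) →*
        (A.fibre s).toAbelianVariety.torsionPoints Ω ((k * N : ℕ) : ℤ)),
      IsPrimitiveRoot ζ (k * N) ∧ Function.Bijective L ∧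
      (∀ i : Fin g ⊕ Fin g, ((L (Multiplicative.ofAdd (Pi.single i 1))) : (A.fibre s).toAbelianVariety.Points Ω) ^ k =
        A.restrictPt s (φ.σ i)) ∧
      ∀ (hMΩ : ((k * N : ℕ) : Ω) ≠ 0) (x y : Fin g ⊕ Fin g → ZMod (k * N)),
        haveI := AbelianVariety.isDominant_toSchemeHom_zsmul_of_ne_zero (A.fibre s).toAbelianVariety hMΩ
        (A.fibre s).toAbelianVariety.weilPairingLevel Θ (L (Multiplicative.ofAdd x)) (L (Multiplicative.ofAdd y)) =
          ζ ^ (typeFormMod δ (k * N) x y).val :=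
  exists_levelDatum_of_transport e he Θ hd

/-- **A level-`kN` symplectic similitude lifting `φ(s)` for the transferred witness `(e⁻¹)^*Θ′` gives one lifting
`φ′(s′)` for `Θ′`** — (T2ₖ) in the literal (S1) shape (the pointwise, single-level step of ★ (T2)
`IsSymplecticLiftable.of_fibreIso`). [cite: Lan2013PELCompactifications, §1.3.6 Lemma 1.3.6.6 and Cor. 1.3.6.7 (pp. 81–82)]
[cite: MumfordAV1970, §20 (property (3) of e_n, p. 186)] -/
theorem LevelStructure.exists_level_of_pullback_inv
    (e : (A'.fibre s').toAbelianVariety ≅ (A.fibre s).toAbelianVariety)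
    (he : ∀ i : Fin g ⊕ Fin g,
      AlgPoints.map e.hom.hom.hom.hom (A'.restrictPt s' (φ'.σ i)) = A.restrictPt s (φ.σ i))
    (Θ' : CartierDivisor (A'.fibre s').toAbelianVariety.X.left)
    (hd : haveI : IsDominant (AbelianVariety.Hom.toSchemeHom e.inv) :=
        AbelianVariety.isDominant_toSchemeHom_iso_hom e.symm
      ∃ (ζ : Ω) (L : Multiplicative (Fin g ⊕ Fin g → ZMod (k * N)) →*
          (A.fibre s).toAbelianVariety.torsionPoints Ω ((k * N : ℕ) : ℤ)),
        IsPrimitiveRoot ζ (k * N) ∧ Function.Bijective L ∧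
        (∀ i : Fin g ⊕ Fin g, ((L (Multiplicative.ofAdd (Pi.single i 1))) : (A.fibre s).toAbelianVariety.Points Ω) ^ k =
          A.restrictPt s (φ.σ i)) ∧
        ∀ (hMΩ : ((k * N : ℕ) : Ω) ≠ 0) (x y : Fin g ⊕ Fin g → ZMod (k * N)),
          haveI := AbelianVariety.isDominant_toSchemeHom_zsmul_of_ne_zero (A.fibre s).toAbelianVariety hMΩ
          (A.fibre s).toAbelianVariety.weilPairingLevel (Θ'.pullback (AbelianVariety.Hom.toSchemeHom e.inv))
              (L (Multiplicative.ofAdd x)) (L (Multiplicative.ofAdd y)) = ζ ^ (typeFormMod δ (k * N) x y).val) :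
    ∃ (ζ : Ω) (L' : Multiplicative (Fin g ⊕ Fin g → ZMod (k * N)) →*
        (A'.fibre s').toAbelianVariety.torsionPoints Ω ((k * N : ℕ) : ℤ)),
      IsPrimitiveRoot ζ (k * N) ∧ Function.Bijective L' ∧
      (∀ i : Fin g ⊕ Fin g, ((L' (Multiplicative.ofAdd (Pi.single i 1))) : (A'.fibre s').toAbelianVariety.Points Ω) ^ k =
        A'.restrictPt s' (φ'.σ i)) ∧
      ∀ (hMΩ : ((k * N : ℕ) : Ω) ≠ 0) (x y : Fin g ⊕ Fin g → ZMod (k * N)),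
        haveI := AbelianVariety.isDominant_toSchemeHom_zsmul_of_ne_zero (A'.fibre s').toAbelianVariety hMΩ
        (A'.fibre s').toAbelianVariety.weilPairingLevel Θ' (L' (Multiplicative.ofAdd x)) (L' (Multiplicative.ofAdd y)) =
          ζ ^ (typeFormMod δ (k * N) x y).val :=
  exists_levelDatum_of_pullback_inv e he Θ' hd

/-- **Symplectic lifts exist for `(φ, s, Θ)` iff they exist for `(φ′, s′, e^*Θ)`** along a fibre isomorphism carrying
the level sections: «⇒» is ★ (T1) `SymplecticLift.nonempty_transport`; «⇐» is (T1) along `e⁻¹` (marks hypothesis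
`map_inv_eq_of_map_hom_eq`) landing on `(e⁻¹)^*e^*Θ ∼ Θ`, then ★ (T0) `SymplecticLift.nonempty_of_linEquiv`.
[cite: Lan2013PELCompactifications, §1.3.6 Lemma 1.3.6.5 (p. 81) and Lemma 1.3.6.6 (pp. 81–82)]
[cite: MumfordAV1970, §20 (property (3) of e_n, p. 186)] -/
theorem LevelStructure.nonempty_symplecticLift_transport_iff
    (e : (A'.fibre s').toAbelianVariety ≅ (A.fibre s).toAbelianVariety)
    (he : ∀ i : Fin g ⊕ Fin g,
      AlgPoints.map e.hom.hom.hom.hom (A'.restrictPt s' (φ'.σ i)) = A.restrictPt s (φ.σ i))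
    (Θ : CartierDivisor (A.fibre s).toAbelianVariety.X.left) :
    Nonempty (φ.SymplecticLift s Θ δ) ↔
      haveI := AbelianVariety.isDominant_toSchemeHom_iso_hom e
      Nonempty (φ'.SymplecticLift s' (Θ.pullback (AbelianVariety.Hom.toSchemeHom e.hom)) δ) := by
  haveI := AbelianVariety.isDominant_toSchemeHom_iso_hom e
  haveI : IsDominant (AbelianVariety.Hom.toSchemeHom e.inv) := AbelianVariety.isDominant_toSchemeHom_iso_hom e.symm
  refine ⟨fun ⟨Λ⟩ => Λ.nonempty_transport (φ' := φ') e he, fun ⟨Λ'⟩ => ?_⟩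
  have he' : ∀ i : Fin g ⊕ Fin g,
      AlgPoints.map e.symm.hom.hom.hom.hom (A.restrictPt s (φ.σ i)) = A'.restrictPt s' (φ'.σ i) :=
    map_inv_eq_of_map_hom_eq e he
  obtain ⟨Λ⟩ := Λ'.nonempty_transport (φ' := φ) e.symm he'
  exact Λ.nonempty_of_linEquiv (pullback_hom_pullback_inv_sameDivisor e Θ).linEquiv

end Fibres

end AbelianSchemeOver

end Literature.AlgebraicGeometry.AbelianSchemes

end
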